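import Literature.Computability.Cryptography.HallgrenClassGroupBlockFP
import Literature.Computability.Cryptography.HallgrenClassGroupHowellFP
import Literature.Computability.Cryptography.CEstFP
import Literature.Computability.Cryptography.OrderFindingPostCF
import Literature.Computability.Complexity.CodeFPListKit
import HarnessLib

/-!
# Hallgren 2005 / class numbers under GRH — the classical post-processor of Kitaev's class-group
# experiment is polynomial time (`clOrderEst` as an `FP` string function)

Topic `Literature/Computability/Cryptography`; proof companion of `HallgrenClassGroupAssembly.lean`
(named fact `Hallgren2005.subgroupOrder_qsolvable`). Definitions and theorems; no named fact. The
read-out `clOrderEst ℓ γ` of `HallgrenClassGroupQuantumEstimates.lean` (Kitaev 1995, §4 p. 15: "The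
results of these measurements are processed in a classical way"; §3 Lemma 10 and Thm. 1: block counts,
quadrant centres, the halving refinement, exact recovery of the rational phase by continued
fractions; Cheung–Mosca 2001, §3: the common denominator and the order of the generated subgroup of
`(ℤ/N)^K`) is specified mathematically — `Finset` counts over the layout equivalence, `refined` over
`ℚ`, `Shor1997.candidate` by unbounded search, `Finset.lcm`, `SubgroupOrder.subgroupOrder` over
`ZMod N`. This file restates it, by proof, as the closed form `clPostVal` that the tree's typed
polynomial-time bricks realise literally, and assembles the `FP` program:

* `seg`, `clCnt_eq_cntL`, `clPhaseEst_eq` — block `(t, i, l, σ)` is the window of the segment of pair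
  `(t, i)` in the layout of `CEstFP.γL`, so `clPhaseEst = refined (βL …)` (`CEstFP.codeFP_refined`);
* `denL`/`clDen_eq` — the phase estimate is a dyadic `A/D`, `D ≤ 2^{Lv+3}`, and Shor's candidate is
  `OFPostCF.cfCandidate` (`cfCandidate_eq_candidate`; the machine `OFPostB.cfScanF`);
* `numrL`, `expL`/`clExp_eq` (`Finset.lcm = Howell.listLcm`), `rowsL`/`clRows_eq`, and
  **`clOrderEst_eq_clPostVal`** (`Howell.subgroupOrderNat_getD_eq_pure`);
* the typed program `clPostValC` (`HowellFP.subgroupOrderPureC` at the end), the string function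
  **`clPost`**, **`clPost_mem_FP`** and **`clPost_boolPair`**:
  `clPost ⟨w, z⟩ = bin (clOrderEst |w| (clReadControls |w| z))`.

## References

* A. Yu. Kitaev, *Quantum measurements and the Abelian Stabilizer Problem*, arXiv:quant-ph/9511026
  (1995), §3 (Lemma 10, Thm. 1), §4 p. 15 [Kitaev1995].
* K. K. H. Cheung, M. Mosca, *Decomposing finite abelian groups*, Quantum Inf. Comput. 1 (2001), §3
  [CheungMosca2001].
* P. W. Shor, SIAM J. Comput. 26 (1997), §5 (continued fractions) [Shor1997].
* S. Arora, B. Barak, *Computational Complexity: A Modern Approach*, CUP 2009, §1.3 [AroraBarak2009].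
-/

noncomputable section

namespace Literature.Computability.Cryptography.Hallgren2005

namespace ClPostFP

open _root_.Computability Literature.Computability.Complexity Literature.Computability.Complexity.CodeFP
  Literature.Computability.Complexity.Brick Polynomial Finset Kitaev1995 OFPostCF ClBlockFP
open PeriodFinding (cntL levelL βL refStep posOf IsDyadic isDyadic_βL isDyadic_foldl_refStep refined_eq_foldl_refStep
  codeFP_refined CE ratRound ratOfNat')
open Literature.Algebra.EuclideanLattices (encodeRat)

/-! ### The closed form of the post-processing -/

/-- The controls of pair `(t, i)` onwards: the measured controls past offset `clOff ℓ t i 0`. [folklore] -/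
def seg (ℓ : ℕ) (y : List Bool) (t i : ℕ) : List Bool := y.drop (clOff ℓ t i 0)

/-- **The phase estimate of pair `(t, i)` in closed form**: the refinement of the level estimates of its
segment. [cite: Kitaev1995, §3 Lemma 10] -/
def phaseL (ℓ : ℕ) (y : List Bool) (t i : ℕ) : ℚ := refined (βL (clLevels ℓ) (clBlockSize ℓ) (seg ℓ y t i)) (clLevels ℓ)

/-- The number of continued-fraction rounds: `2 (Lv + 4) + 1`. [folklore] -/
def cfBudget (ℓ : ℕ) : ℕ := 2 * (clLevels ℓ + 4) + 1

/-- **The recovered denominator in closed form**: Shor's candidate by continued fractions on the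
dyadic `A/D = phaseL`. [cite: Shor1997, §5; Kitaev1995, §3 Thm 1] -/
def denL (ℓ : ℕ) (y : List Bool) (t i : ℕ) : ℕ :=
  cfCandidate (clN ℓ) (clQ ℓ) (phaseL ℓ y t i).num.toNat (phaseL ℓ y t i).den (cfBudget ℓ)

/-- The recovered numerator in closed form. [cite: Kitaev1995, §3 Thm 1] -/
def numrL (ℓ : ℕ) (y : List Bool) (t i : ℕ) : ℕ := roundMul (denL ℓ y t i) (phaseL ℓ y t i)

/-- The (trial, slot) pairs. [folklore] -/
def pairsL (ℓ : ℕ) : List (ℕ × ℕ) := List.product (List.range (clTrials ℓ)) (List.range (clSlots ℓ))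

/-- **The common denominator in closed form**: the `lcm` of the recovered denominators. [cite: CheungMosca2001, §3] -/
def expL (ℓ : ℕ) (y : List Bool) : ℕ := Howell.listLcm ((pairsL ℓ).map fun p => denL ℓ y p.1 p.2)

/-- **The coordinate rows in closed form.** [cite: CheungMosca2001, §3] -/
def rowsL (ℓ : ℕ) (y : List Bool) : List (List ℕ) :=
  (List.range (clTrials ℓ)).map fun t => (List.range (clSlots ℓ)).map fun i => numrL ℓ y t i * (expL ℓ y / denL ℓ y t i)

/-- **The order read off the controls, in closed form.** [cite: CheungMosca2001, §3; Kitaev1995, §4 p. 15] -/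
def clPostVal (ℓ : ℕ) (y : List Bool) : ℕ := Howell.subgroupOrderPure (expL ℓ y) (clSlots ℓ) (rowsL ℓ y)

/-! ### The closed form is the specification -/

section Spec

variable (ℓ : ℕ) (z : List Bool)

/-- **A block count is a window count of the segment** of its pair. [cite: Kitaev1995, §3 (before Lemma 9)] -/
theorem clCnt_eq_cntL (t : Fin (clTrials ℓ)) (i : Fin (clSlots ℓ)) (l : Fin (clLevels ℓ)) (σ : Bool) :
    clCnt (t, i, l, σ) (clReadControls ℓ z) = cntL (clBlockSize ℓ) (seg ℓ (z.drop ℓ) t i) l σ := by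
  classical
  have getD_drop' : ∀ (w : List Bool) (m n : ℕ), (w.drop m).getD n false = w.getD (m + n) false := fun w m n => by
    rw [List.getD_eq_getElem?_getD, List.getElem?_drop, ← List.getD_eq_getElem?_getD]
  rw [clCnt, clBlock_eq_image, filter_image, card_image_of_injective _ fun r r' h => by simpa using h, card_filter,
    cntL, sum_map_range, Finset.sum_range]
  refine Finset.sum_congr rfl fun r _ => ?_
  simp only [clReadControls, val_clLayout_symm, seg, posOf]
  rw [getD_drop', getD_drop',
    show ℓ + (clOff ℓ t i 0 + ((r : ℕ) + clBlockSize ℓ * σ.toNat + 2 * clBlockSize ℓ * l)) =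
      ℓ + (clOff ℓ t i l + σ.toNat * clBlockSize ℓ + r) by unfold clOff; ring]
  cases z.getD _ false <;> simp

/-- **The phase estimate is the closed form.** [cite: Kitaev1995, §3 Lemma 10] -/
theorem clPhaseEst_eq (t : Fin (clTrials ℓ)) (i : Fin (clSlots ℓ)) :
    clPhaseEst ℓ (clReadControls ℓ z) t i = phaseL ℓ (z.drop ℓ) t i := by
  have hβ : (fun l => if h : l < clLevels ℓ then clLevelEst ℓ (clReadControls ℓ z) t i ⟨l, h⟩ else 0) =
      βL (clLevels ℓ) (clBlockSize ℓ) (seg ℓ (z.drop ℓ) t i) := by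
    funext l
    by_cases h : l < clLevels ℓ
    · rw [dif_pos h, βL, if_pos h, clLevelEst, levelL, clCnt_eq_cntL, clCnt_eq_cntL]
    · rw [dif_neg h, βL, if_neg h]
  unfold clPhaseEst phaseL
  rw [hβ]

/-- The closed-form phase estimate is a dyadic of depth `Lv + 3`. [folklore] -/
theorem isDyadic_phaseL (y : List Bool) (t i : ℕ) : IsDyadic (phaseL ℓ y t i) (3 + clLevels ℓ) := by
  rw [phaseL, refined_eq_foldl_refStep]
  have h := isDyadic_foldl_refStep (Lv := clLevels ℓ) (B := clBlockSize ℓ) (seg ℓ y t i) (List.range (clLevels ℓ))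
    (isDyadic_βL (Lv := clLevels ℓ) (B := clBlockSize ℓ) (seg ℓ y t i) (clLevels ℓ - 1))
  simpa using h

/-- A dyadic has a nonnegative numerator and a denominator at most `2^e`. [folklore] -/
theorem num_nonneg_den_le {a : ℚ} {e : ℕ} (h : IsDyadic a e) : 0 ≤ a.num ∧ a.den ≤ 2 ^ e := by
  obtain ⟨m, rfl, hm⟩ := h
  refine ⟨Rat.num_nonneg.2 (by positivity), ?_⟩
  have hq : (m : ℚ) / 2 ^ e = Rat.divInt m ((2 ^ e : ℕ) : ℤ) := by
    rw [Rat.divInt_eq_div]; push_cast; rfl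
  have hd := Rat.den_dvd (m : ℤ) ((2 ^ e : ℕ) : ℤ)
  rw [← hq] at hd
  have : (((m : ℚ) / 2 ^ e).den : ℤ) ≤ ((2 ^ e : ℕ) : ℤ) := Int.le_of_dvd (by positivity) hd
  exact_mod_cast this

/-- **The recovered denominator is the closed form** (Legendre/Shor uniqueness: `cfCandidate_eq_candidate`).
[cite: Shor1997, §5; Kitaev1995, §3 Thm 1] -/
theorem clDen_eq (t : Fin (clTrials ℓ)) (i : Fin (clSlots ℓ)) : clDen ℓ (clReadControls ℓ z) t i = denL ℓ (z.drop ℓ) t i := by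
  rw [clDen, clPhaseEst_eq, denL]
  set φ := phaseL ℓ (z.drop ℓ) t i with hφ
  obtain ⟨hnum, hden⟩ := num_nonneg_den_le (isDyadic_phaseL ℓ (z.drop ℓ) t i)
  have hDs : φ.den < 2 ^ (clLevels ℓ + 4) :=
    lt_of_le_of_lt hden (Nat.pow_lt_pow_right (by norm_num) (by omega))
  rw [cfCandidate_eq_candidate (le_of_eq (clN_sq ℓ)) φ.den_pos hDs (by unfold cfBudget; omega)]
  congr 1
  rw [Rat.cast_def]
  congr 1
  have : ((φ.num.toNat : ℕ) : ℤ) = φ.num := Int.toNat_of_nonneg hnum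
  exact_mod_cast this.symm

/-- The recovered numerator is the closed form. [cite: Kitaev1995, §3 Thm 1] -/
theorem clNumr_eq (t : Fin (clTrials ℓ)) (i : Fin (clSlots ℓ)) : clNumr ℓ (clReadControls ℓ z) t i = numrL ℓ (z.drop ℓ) t i := by
  rw [clNumr, numrL, clDen_eq, clPhaseEst_eq]

/-- **The common denominator is the closed form** (`Finset.lcm` over the pairs is the list `lcm`). [cite: CheungMosca2001, §3] -/
theorem clExp_eq : clExp ℓ (clReadControls ℓ z) = expL ℓ (z.drop ℓ) := by
  have hmem : ∀ x : ℕ, x ∈ (pairsL ℓ).map (fun p => denL ℓ (z.drop ℓ) p.1 p.2) ↔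
      ∃ p : Fin (clTrials ℓ) × Fin (clSlots ℓ), clDen ℓ (clReadControls ℓ z) p.1 p.2 = x := by
    intro x
    simp only [pairsL, List.mem_map]
    constructor
    · rintro ⟨⟨a, b⟩, hab, rfl⟩
      rw [List.pair_mem_product, List.mem_range, List.mem_range] at hab
      exact ⟨(⟨a, hab.1⟩, ⟨b, hab.2⟩), clDen_eq ℓ z _ _⟩
    · rintro ⟨⟨a, b⟩, rfl⟩
      exact ⟨(a, b), List.pair_mem_product.2 ⟨List.mem_range.2 a.isLt, List.mem_range.2 b.isLt⟩, (clDen_eq ℓ z a b).symm⟩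
  refine Nat.dvd_antisymm ?_ ?_
  · rw [clExp, Finset.lcm_dvd_iff]
    intro p _
    refine (Howell.listLcm_dvd_iff.1 dvd_rfl) _ ((hmem _).2 ⟨p, rfl⟩)
  · rw [expL, Howell.listLcm_dvd_iff]
    intro x hx
    obtain ⟨p, rfl⟩ := (hmem x).1 hx
    rw [clExp]
    exact Finset.dvd_lcm (mem_univ p)

/-- **The coordinate rows are the closed form.** [cite: CheungMosca2001, §3] -/
theorem clRows_eq : clRows ℓ (clReadControls ℓ z) = (rowsL ℓ (z.drop ℓ)).map fun r (i : Fin (clSlots ℓ)) => r.getD i 0 := by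
  rw [clRows, rowsL, ← List.map_coe_finRange_eq_range (n := clTrials ℓ), List.map_map, List.map_map]
  refine List.map_congr_left fun t _ => ?_
  funext i
  simp only [Function.comp_apply]
  rw [Howell.getD_map_range i.isLt, clNumr_eq, clExp_eq, clDen_eq]

/-- **The read-out is the closed form**: `clOrderEst ℓ (clReadControls ℓ z) = clPostVal ℓ (z ⇂ ℓ)`.
[cite: Kitaev1995, §4 p. 15; CheungMosca2001, §3] -/
theorem clOrderEst_eq_clPostVal : clOrderEst ℓ (clReadControls ℓ z) = clPostVal ℓ (z.drop ℓ) := by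
  rw [clOrderEst, clRows_eq, clExp_eq, Howell.subgroupOrderNat_getD_eq_pure, clPostVal]

end Spec

/-! ### The typed program -/

/-- The context code `(1^ℓ, y)`. [folklore] -/
abbrev PE : ℕ × List Bool → List Bool := pairE unE strE

/-- Unary multiplication. [folklore] -/
theorem unMul : CodeFP (pairE unE unE) unE (fun p => p.1 * p.2) :=
  ((ulength unitE).comp (unitsMul.comp ((replicateUnit.comp (fst unE unE)).pair (replicateUnit.comp (snd unE unE))))).congr
    fun p => by simp

/-- `clBlockSize` in unary. [folklore] -/
theorem clBlockSizeU : CodeFP unE unE clBlockSize := by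
  have hid := CodeFP.id unE
  have hNB := unMul.comp (clTrialsU.pair (unMul.comp (hid.pair (unMul.comp (clLevelsU.pair (const unE (2 : ℕ)))))))
  have h := (unMulConst 768).comp (unAdd.comp (hNB.pair (const unE (1 : ℕ))))
  exact h.congr fun n => by simp [clBlockSize, clNumBlocks, clSlots]

/-- `cfBudget` in unary. [folklore] -/
theorem cfBudgetU : CodeFP unE unE cfBudget :=
  (unSucc.comp ((unMulConst 2).comp (unAdd.comp (clLevelsU.pair (const unE (4 : ℕ)))))).congr fun n => by simp [cfBudget]

/-- `seg` on codes, arguments `((ℓ, y), (t, i))`. [folklore] -/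
theorem segC : CodeFP XE strE (fun q => seg q.1.1 q.1.2 q.2.1 q.2.2) := by
  have hy : CodeFP XE strE (fun q => q.1.2) := (fst _ _).snd'
  have hoff := clOffC.comp ((CodeFP.id XE).pair (const XE (0 : ℕ)))
  have hoffU := unOfNatMin.comp ((strLength.comp hy).pair hoff)
  refine ((strDrop.comp (hoffU.pair hy)) :).congr fun q => ?_
  simp only [seg, id]
  rcases le_or_gt (clOff q.1.1 q.2.1 q.2.2 0) q.1.2.length with h | h
  · rw [min_eq_left h]
  · rw [min_eq_right h.le, List.drop_eq_nil_of_le le_rfl, List.drop_eq_nil_of_le h.le]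

/-- **The phase estimate on codes** (`CEstFP.codeFP_refined` on the context `(0, 1^{Lv}, 1^{B}, seg)`).
[cite: Kitaev1995, §3 Lemma 10] -/
theorem phaseC : CodeFP XE encodeRat (fun q => phaseL q.1.1 q.1.2 q.2.1 q.2.2) := by
  have hℓ : CodeFP XE unE (fun q => q.1.1) := (fst _ _).fst'
  have hce := (const (eβ := natE) XE (0 : ℕ)).pair ((clLevelsU.comp hℓ).pair ((clBlockSizeU.comp hℓ).pair segC))
  refine ((codeFP_refined.comp hce) :).congr fun q => ?_
  exact (refined_eq_foldl_refStep (Lv := clLevels q.1.1) (B := clBlockSize q.1.1) _).symm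

/-- The arguments of the continued-fraction scan coded as the machine reads them. [folklore] -/
def cfE : ℕ × ℕ × ℕ × ℕ × ℕ → List Bool := fun p => boolPair (OFPostB.xrec p.1 p.2.1 p.2.2.1 p.2.2.2.1) (unE p.2.2.2.2)

/-- **Shor's candidate by continued fractions on codes** (`OFPostB.cfScanF`). [cite: Shor1997, §5] -/
theorem cfC : CodeFP cfE natE (fun p => cfCandidate p.1 p.2.1 p.2.2.1 p.2.2.2.1 p.2.2.2.2) :=
  of_fn OFPostB.cfScanF OFPostB.cfScanF_mem_FP fun p => by
    rw [cfE, OFPostB.cfScanF_apply, length_unE]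

/-- **The recovered denominator on codes.** [cite: AroraBarak2009, §1.3] -/
theorem denC : CodeFP XE natE (fun q => denL q.1.1 q.1.2 q.2.1 q.2.2) := by
  have hℓ : CodeFP XE unE (fun q => q.1.1) := (fst _ _).fst'
  have h2 : CodeFP XE natE (fun _ => (2 : ℕ)) := const XE (2 : ℕ)
  have hN := natPow.comp (h2.pair ((unMulConst 2).comp hℓ))
  have hQ := natPow.comp (h2.pair ((unMulConst 4).comp hℓ))
  have hnd := ratNumDen.comp phaseC
  have hA := intToNat.comp hnd.fst'
  have hx := (hN.pair ((natMul.comp (h2.pair hQ)).pair (hA.pair hnd.snd'))).pair (cfBudgetU.comp hℓ)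
  have hx' : CodeFP XE cfE (fun q => (clN q.1.1, clQ q.1.1, (phaseL q.1.1 q.1.2 q.2.1 q.2.2).num.toNat,
      (phaseL q.1.1 q.1.2 q.2.1 q.2.2).den, cfBudget q.1.1)) :=
    hx.recodeOut fun q => by simp only [cfE, OFPostB.xrec, pairE_apply, clN, clQ]
  exact ((cfC.comp hx') :).congr fun q => rfl

/-- **The recovered numerator on codes**: `round(φ q) mod q`. [cite: Kitaev1995, §3 Thm 1] -/
theorem numrC : CodeFP XE natE (fun q => numrL q.1.1 q.1.2 q.2.1 q.2.2) := by
  have hr := ratRound.comp (ratMul.comp (phaseC.pair (ratOfNat'.comp denC)))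
  have hM := intOfNat.comp denC
  have hmod := intSub.comp (hr.pair (intMul.comp (hM.pair (intEDiv.comp (hr.pair hM)))))
  refine ((intToNat.comp hmod) :).congr fun q => ?_
  simp only [numrL, roundMul]
  rw [Int.emod_def]

/-- The pairs on codes. [folklore] -/
theorem pairsC : CodeFP unE (rawE (pairE natE natE)) pairsL :=
  ((rawProduct natE natE).comp ((urange.comp clTrialsU).pair urange)).congr fun _ => rfl

/-- **The common denominator on codes.** [cite: CheungMosca2001, §3] -/
theorem expC : CodeFP PE natE (fun p => expL p.1 p.2) := by
  have h := (map denC).comp ((CodeFP.id PE).pair (pairsC.comp (fst unE strE)))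
  exact ((HowellFP.listLcmC.comp h) :).congr fun p => rfl

/-- **The rows on codes.** [cite: CheungMosca2001, §3] -/
theorem rowsC : CodeFP PE HowellFP.rowsE (fun p => rowsL p.1 p.2) := by
  -- inner items `(((p, N), t), i)`
  have hq : CodeFP (pairE (pairE (pairE PE natE) natE) natE) XE (fun r => (r.1.1.1, (r.1.2, r.2))) :=
    (fst _ _).fst'.fst'.pair ((fst _ _).snd'.pair (snd _ _))
  have hN : CodeFP (pairE (pairE (pairE PE natE) natE) natE) natE (fun r => r.1.1.2) := (fst _ _).fst'.snd'
  have hitem := natMul.comp ((numrC.comp hq).pair (natDiv.comp (hN.pair (denC.comp hq))))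
  -- the row of trial `t`: context `((p, N), t)`, items `i < clSlots ℓ = ℓ`
  have hrow := (map hitem).comp ((CodeFP.id (pairE (pairE PE natE) natE)).pair (urange.comp (fst _ _).fst'.fst'))
  -- all rows: context `(p, N)`, items `t < clTrials ℓ`
  have hrows := (map hrow).comp ((CodeFP.id (pairE PE natE)).pair (urange.comp (clTrialsU.comp (fst _ _).fst')))
  have h := hrows.comp ((CodeFP.id PE).pair expC)
  refine (h :).congr fun p => ?_
  simp only [rowsL, id, clSlots]

/-- **The closed form on codes** (`HowellFP.subgroupOrderPureC` on `(N, 1^{K}, rows)`). [cite: CheungMosca2001, §3; AroraBarak2009, §1.3] -/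
theorem clPostValC : CodeFP PE natE (fun p => clPostVal p.1 p.2) := by
  have h := HowellFP.subgroupOrderPureC.comp (expC.pair ((fst unE strE).pair rowsC))
  exact (h :).congr fun p => by simp only [clPostVal, clSlots]

/-! ### The string function -/

/-- **The classical post-processor of the class-group experiment** on `⟨w, z⟩` (input, measured
string): the numeral of `clPostVal |w| (z ⇂ |w|)`. [cite: Kitaev1995, §4 p. 15 ("processed in a classical way")] -/
def clPost (s : List Bool) : List Bool := natE (clPostVal (fstF s).length ((sndF s).drop (fstF s).length))

/-- The post-processor on codes. [folklore] -/
theorem clPostC : CodeFP strE natE (fun s => clPostVal (fstF s).length ((sndF s).drop (fstF s).length)) := by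
  have hℓ := strLength.comp fstFC
  have h := clPostValC.comp (hℓ.pair (strDrop.comp (hℓ.pair sndFC)))
  exact (h :).congr fun s => rfl

/-- **`clPost ∈ FP`.** [cite: Kitaev1995, §3 Lemma 10 ("by a polynomial algorithm"), §4 p. 15; AroraBarak2009, §1.3] -/
theorem clPost_mem_FP : clPost ∈ FP := by
  obtain ⟨f, hf, h⟩ := clPostC
  have : f = clPost := funext fun s => h s
  rw [← this]; exact hf

/-- **The post-processor computes `clOrderEst`** on the pair of the input and the measured string.
[cite: Kitaev1995, §4 p. 15; CheungMosca2001, §3] -/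
theorem clPost_boolPair (w z : List Bool) :
    clPost (boolPair w z) = encodeNat (clOrderEst w.length (clReadControls w.length z)) := by
  rw [clPost, fstF_boolPair, sndF_boolPair, clOrderEst_eq_clPostVal]

end ClPostFP

end Literature.Computability.Cryptography.Hallgren2005

end
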